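import Summits.Langlands.Langlands.Theses.ExteriorSquareAscent
import Literature.NumberTheory.Automorphic.AutomorphicInductionCuspidal
import Literature.NumberTheory.Automorphic.GaloisActionPlaces
import Literature.NumberTheory.GaloisRepresentations.HeckeCharacter
import HarnessLib

/-!
# Route `ExteriorSquareAscent`, crux `SelfTwistedIrreducible` (stmt-Langlands-18055): vocabulary of the
# line `Sketch` (idea det-pinning)

Route-posited objects (D-0016 `<Route>Defs`-type file) shared by the registered stubs of the checked
skeleton `Cruxes/SelfTwistedIrreducible/Lines/Sketch.lean` (lead prover-line-stmt-Langlands-18055-0) and by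
the crux file that composes them.  NOTHING IS ASSERTED by the definitions: every `def … : Prop` below is a
*statement* consumed only as (part of) the type of a stub theorem or of the crux.  Declared in the
skeleton's namespace `Summit.Langlands.Langlands.Cruxes.SelfTwistedIrreducible.DetPinning`, so that a landed
stub `theorem stub_<name> : <registered signature>` reads byte-identically to its registration.

Objects (all over existing carriers: `CuspidalAutomorphicRepData`, `HasSatakeParamAt`, `FramedGaloisRep`,
`IsUnramifiedAt`, `HasFrobCharpolyAt`, `arithFrobPolyOfSatake`, `HeckeCharacter.valueAtUniformizer`, the
`Gal(L/K)`-action `τ • w` on places of `GaloisActionPlaces`):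
* `HasHeckeField π`, `IsQuadSelfTwisted π L`, `IsCompatibleWith π ι ρ` — the crux's Hecke-field,
  self-twist and compatibility clauses, VERBATIM (`SelfTwistedIrreducible` unfolds to them, `Iff.rfl`);
* `IsSumOfFourCharacters ρ'` — shape (A) of `ρ' : Γ_L → GL₄(ℚ̄_ℓ)`: four continuous characters whose values
  are the roots of every `charpoly ρ'(σ)`;
* `IsDoubled ρ'` — shape (B): `charpoly ρ'(σ) = (charpoly W(σ))²` for a continuous `W : Γ_L → GL₂(ℚ̄_ℓ)`
  (no irreducibility of `W` is asked: the line never uses it);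
* `IsRationalAE ρ'` — `ρ'` is unramified with Frobenius characteristic polynomial in `E[X]` at almost every
  place, for some number field `E` with an embedding `e : E → ℚ̄_ℓ` (the hypothesis shape of the tree's
  Böckle–Hui theorem `exists_heckeCharacter_of_weaklyDivides`, inlined `IsRationalOver`);
* `IsCompatibleAlong τ f ι ρ'` — at almost every place `w` of `L`, whenever `f` has Satake parameters `β`
  at `w` and `β'` at `τ • w`, `ρ'` is unramified at `w` with arithmetic-Frobenius characteristic polynomial
  `arithFrobPolyOfSatake ι q_w 4 (β + β')` (C-normalisation `m = 4`, as in the crux): "`ρ'` is compatible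
  with the isobaric `f ⊞ f^τ`", the tree having no isobaric-sum datum;
* `HasPinnedDoubling τ f χ` — at almost every `w`: `t_{f,w} ⊔ t_{f,τw} = {x, x, y, y}` and
  `χ(ϖ_w) = q_w³ · x y` for the Hecke character `χ` of `L` (the determinant pinning of idea det-pinning).

References: Shavali2026 = arXiv:2603.19768 Cor. 4.6 (the induced case this crux redoes without Galois
representations over `L`); BockleHui2025 Thm 1.1 (tree, proved); ArthurClozelAMS120 Ch. 3 Def. 6.1, Thm 4.2.
-/

set_option linter.dupNamespace false -- `Summit.Langlands.Langlands` is the mandated namespace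

noncomputable section

namespace Summit.Langlands.Langlands.Cruxes.SelfTwistedIrreducible.DetPinning

open scoped NumberField Polynomial Classical
open Filter Polynomial NumberField IsDedekindDomain Field
open Literature.NumberTheory.GaloisRepresentations Literature.NumberTheory.Automorphic

/-! The `if … then 1 else -1` of `IsQuadSelfTwisted` is the crux's, elaborated with the classical
`Decidable` instance (`open scoped Classical`, as in the route file), so that the read-back below is
`Iff.rfl`. -/

section Interfaces

variable {K : Type} [Field K] [NumberField K] {hcpt : isCompact_glFiniteIntegralLevel 4 K}

/-- The crux's HECKE-FIELD clause for `π` on `GL₄(𝔸_K)`, VERBATIM: a number field `E ⊂ ℂ` containing the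
C-normalised Hecke-polynomial coefficients `q_v^{i(4-i)/2} e_i(t_{π,v})` at almost every `v`. [folklore] -/
def HasHeckeField (π : CuspidalAutomorphicRepData 4 K hcpt) : Prop :=
  ∃ E : Subfield ℂ, FiniteDimensional ℚ E ∧ ∀ᶠ v in cofinite, ∀ α : Multiset ℂ, π.1.HasSatakeParamAt v α → ∀ i ≤ 4, ((((Real.sqrt (v.residueCard : ℝ)) : ℝ) : ℂ) ^ (i * (4 - i))) * α.esymm i ∈ E

/-- The crux's SELF-TWIST clause, VERBATIM, for a given `L/K`: `[L : K] = 2` and, at almost every finite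
place `v` of `K`, `ε_{L/K}(v) · t_{π,v} = t_{π,v}` as multisets (`ε_{L/K}(v)` = the tree's
`quadraticSign L v`). [folklore] -/
def IsQuadSelfTwisted (π : CuspidalAutomorphicRepData 4 K hcpt) (L : Type) [Field L] [NumberField L]
    [Algebra K L] : Prop :=
  Module.finrank K L = 2 ∧ ∀ᶠ v : HeightOneSpectrum (𝓞 K) in cofinite, ∀ α : Multiset ℂ, π.1.HasSatakeParamAt v α → α.map (fun a => (if ∃ w : HeightOneSpectrum (𝓞 L), w.asIdeal.under (𝓞 K) = v.asIdeal ∧ w.asIdeal.inertiaDeg (𝓞 K) = 1 then (1 : ℂ) else -1) * a) = α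

/-- The crux's COMPATIBILITY clause, VERBATIM: at almost every `v`, `π` is unramified with a Satake
parameter `α`, `ρ` is unramified, and every arithmetic Frobenius at `v` has characteristic polynomial
`arithFrobPolyOfSatake ι q_v 4 α`. [folklore] -/
def IsCompatibleWith (π : CuspidalAutomorphicRepData 4 K hcpt) {ℓ : ℕ} [Fact ℓ.Prime]
    (ι : PadicAlgCl ℓ ≃+* ℂ) (ρ : FramedGaloisRep K (PadicAlgCl ℓ) 4) : Prop :=
  ∀ᶠ v : HeightOneSpectrum (𝓞 K) in cofinite, ∃ α : Multiset ℂ, π.1.HasSatakeParamAt v α ∧ ρ.IsUnramifiedAt v ∧ ρ.HasFrobCharpolyAt v (arithFrobPolyOfSatake ι v.residueCard 4 α)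

variable {L : Type} [Field L] {ℓ : ℕ} [Fact ℓ.Prime]

/-- Shape (A) of `ρ' : Γ_L → GL₄(ℚ̄_ℓ)` — a SUM OF FOUR CHARACTERS at the level of characteristic
polynomials: continuous `χ₀, …, χ₃ : Γ_L → ℚ̄_ℓˣ` with `charpoly ρ'(σ) = ∏ᵢ (X - χᵢ(σ))` for every `σ`.
[folklore] -/
def IsSumOfFourCharacters (ρ' : FramedGaloisRep L (PadicAlgCl ℓ) 4) : Prop :=
  ∃ χ : Fin 4 → (absoluteGaloisGroup L →ₜ* (PadicAlgCl ℓ)ˣ),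
    ∀ σ : absoluteGaloisGroup L, (ρ' σ).val.charpoly = ∏ i, (X - C ((χ i σ : (PadicAlgCl ℓ)ˣ) : PadicAlgCl ℓ))

/-- Shape (B) — DOUBLED: a continuous `W : Γ_L → GL₂(ℚ̄_ℓ)` with `charpoly ρ'(σ) = (charpoly W(σ))²` for
every `σ` (for semisimple `ρ'`: `ρ' ≅ W ⊕ W`; irreducibility of `W` is NOT asked). [folklore] -/
def IsDoubled (ρ' : FramedGaloisRep L (PadicAlgCl ℓ) 4) : Prop :=
  ∃ W : FramedGaloisRep L (PadicAlgCl ℓ) 2,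
    ∀ σ : absoluteGaloisGroup L, (ρ' σ).val.charpoly = ((W σ).val.charpoly) ^ 2

variable [NumberField L]

/-- `ρ'` is `E`-RATIONAL ALMOST EVERYWHERE for some number field `E` embedded in `ℚ̄_ℓ` by `e`:
unramified with Frobenius characteristic polynomial in `e(E[X])` at almost every place (the tree's
`FramedGaloisRep.IsRationalOver e ρ'`, with `E`, `e` existentially quantified). [folklore] -/
def IsRationalAE (ρ' : FramedGaloisRep L (PadicAlgCl ℓ) 4) : Prop :=
  ∃ (E : Type) (_ : Field E) (_ : NumberField E) (e : E →+* PadicAlgCl ℓ),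
    ∀ᶠ w : HeightOneSpectrum (𝓞 L) in cofinite, ρ'.IsUnramifiedAt w ∧ ∃ P : Polynomial E, ρ'.HasFrobCharpolyAt w (P.map e)

variable [Algebra K L]

/-- COMPATIBILITY OF `ρ' : Γ_L → GL₄(ℚ̄_ℓ)` WITH `f ⊞ f^τ` almost everywhere (C-normalisation `m = 4`): at
almost every place `w` of `L`, for Satake parameters `β` of `f` at `w` and `β'` of `f` at `τ • w`, `ρ'` is
unramified at `w` and its arithmetic Frobenii at `w` have characteristic polynomial
`arithFrobPolyOfSatake ι q_w 4 (β + β')`. [folklore] -/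
def IsCompatibleAlong (τ : L ≃ₐ[K] L) {hL2 : isCompact_glFiniteIntegralLevel 2 L}
    (f : CuspidalAutomorphicRepData 2 L hL2) (ι : PadicAlgCl ℓ ≃+* ℂ)
    (ρ' : FramedGaloisRep L (PadicAlgCl ℓ) 4) : Prop :=
  ∀ᶠ w : HeightOneSpectrum (𝓞 L) in cofinite, ∀ β β' : Multiset ℂ, f.1.HasSatakeParamAt w β →
    f.1.HasSatakeParamAt (τ • w) β' →
      ρ'.IsUnramifiedAt w ∧ ρ'.HasFrobCharpolyAt w (arithFrobPolyOfSatake ι w.residueCard 4 (β + β'))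

/-- PINNED DOUBLING of `f` along `τ` by the Hecke character `χ` of `L`: at almost every place `w`, for
Satake parameters `β` of `f` at `w` and `β'` at `τ • w`, `β ⊔ β' = {x, x, y, y}` and
`χ(ϖ_w) = q_w³ · x y`. [folklore] -/
def HasPinnedDoubling (τ : L ≃ₐ[K] L) {hL2 : isCompact_glFiniteIntegralLevel 2 L}
    (f : CuspidalAutomorphicRepData 2 L hL2) (χ : HeckeCharacter L) : Prop :=
  ∀ᶠ w : HeightOneSpectrum (𝓞 L) in cofinite, ∀ β β' : Multiset ℂ, f.1.HasSatakeParamAt w β →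
    f.1.HasSatakeParamAt (τ • w) β' →
      ∃ x y : ℂ, β + β' = {x, x, y, y} ∧ χ.valueAtUniformizer w = ((w.residueCard : ℕ) : ℂ) ^ 3 * (x * y)

end Interfaces

/-- Read-back: the crux `SelfTwistedIrreducible` with its three clauses named (definitional unfolding
only). [folklore] -/
theorem selfTwistedIrreducible_iff :
    Summit.Langlands.Langlands.Theses.ExteriorSquareAscent.SelfTwistedIrreducible ↔
    ∀ (K : Type) [Field K] [NumberField K] (hcpt : isCompact_glFiniteIntegralLevel 4 K)
      (π : CuspidalAutomorphicRepData 4 K hcpt), π.1.IsCAlgebraic → HasHeckeField π →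
        (∃ (L' : Type) (_ : Field L') (_ : NumberField L') (_ : Algebra K L'), IsQuadSelfTwisted π L') →
          ∀ (ℓ : ℕ) [Fact ℓ.Prime] (ι : PadicAlgCl ℓ ≃+* ℂ) (ρ : FramedGaloisRep K (PadicAlgCl ℓ) 4),
            ρ.toGaloisRep.IsSemisimple → IsCompatibleWith π ι ρ → ρ.toGaloisRep.IsIrreducible :=
  Iff.rfl

end Summit.Langlands.Langlands.Cruxes.SelfTwistedIrreducible.DetPinning

end
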